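import Literature.Dynamics.NBody.PlanarCCRigidity
import Mathlib.LinearAlgebra.Matrix.Rank
import Mathlib.Tactic
import HarnessLib

/-!
# The S3 dictionary: positive central configurations satisfy the ENRICHED torus system

The cell's tropical certificates on the exceptional family `E32 = {(a,a,b,b,c)}` are computed not
only for the Jensen–Leykin equation set S1 = {`g_ij`, four-body Cayley–Menger} (tree file
`JensenLeykin2025.lean`, `jlNormalizedCCs`) but for the richer sets S2 ⊂ S3, which add
[HamptonJensen2011, §2 p. 4, eq. (7)]:

* the RANK CONDITION `cmRankLE4 r`: all `5 × 5` minors and the determinant of the `6 × 6` bordered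
  Cayley–Menger matrix of the five bodies vanish (rank ≤ 4 = planarity of five points);
* the ENERGY RELATION `eIU m r = Σ_{i<j} m_i m_j (r_ij⁻¹ − r_ij²) = 0` (`U = I` at the
  Jensen–Leykin / Hampton–Jensen normalisation).

These extra equations are identities of REAL central configurations, not consequences of S1 on the
complex torus, so a finiteness certificate for the S3 solution set `s3NormalizedCCs` needs its own
dictionary before it says anything about [AlbouyKaloshin2012, Definition 1].  This file supplies it,
kernel-checked:

* `cmRankLE4_of_planar` — any field: `r_ij² = (x_i−x_j)² + (y_i−y_j)²` ⇒ `cmRankLE4 r`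
  (rank factorisation of the bordered matrix through `K⁴`, `det_mul_eq_zero_of_card_lt`);
* `realCC_potential_identity` (`Σ m_k|q_k|² = ½ Σ_{k≠l} m_k m_l δ_kl`, from system (4)) and
  `realCC_lagrange_identity` (`M Σ m_k|q_k|² = ½ Σ_{k,l} m_k m_l r_kl²`, centre of mass `0`);
* `eIU_jlOfDelta_eq_zero` — for every real normalized CC `(q, δ)` of (4) (any `n`, signed `δ`
  allowed) and `κ³ Σ m = 1`: `eIU m (κ/δ) = 0`;
* `jlOfDelta_deltaOfPos_mem_s3` — a positive normalized CC of five bodies maps into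
  `s3NormalizedCCs ℝ m`; hence `positiveNormalizedCCs_finite_of_s3Finite`
  (`Σ m > 0`: S3 solution set finite at `m` ⇒ finitely many positive normalized CCs at `m`) and
  `e32_generic_positiveCC_finite_of_s3Target` (an S3 certificate generic on `E32` decides
  AK-finiteness generically on `E32`, same exceptional polynomial `P(a,b,c)`).

`cmBordered5`, `cmRankLE4`, `eIU` (at `n = 5`) and `s3NormalizedCCs` are character-for-character the
cell's staging definitions (`Smale6N5TropicalE32.lean`), so the bridge to the staged targets is `rfl`.
-/

namespace Literature.Dynamics.NBody

open Finset

/-- A product through a smaller index type has zero determinant (rank bound). [folklore] -/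
theorem det_mul_eq_zero_of_card_lt {ι k K : Type*} [Fintype ι] [DecidableEq ι] [Fintype k]
    [DecidableEq k] [Field K] (P : Matrix ι k K) (Q : Matrix k ι K)
    (h : Fintype.card k < Fintype.card ι) : (P * Q).det = 0 := by
  by_contra hne
  have hU : IsUnit (P * Q) :=
    (Matrix.isUnit_iff_isUnit_det _).mpr (isUnit_iff_ne_zero.mpr hne)
  have h1 := Matrix.rank_of_isUnit _ hU
  have h2 : (P * Q).rank ≤ Fintype.card k :=
    (Matrix.rank_mul_le_left _ _).trans (Matrix.rank_le_card_width _)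
  omega

/-- The `6 × 6` bordered Cayley–Menger matrix of five bodies (border index `0`, body `i` at index
`i.succ`; entries squared "distances", zero diagonal) — verbatim the cell's staging definition.
[cite: HamptonJensen2011, §2 p. 4] -/
def cmBordered5 {K : Type*} [Field K] (r : Fin 5 → Fin 5 → K) : Matrix (Fin 6) (Fin 6) K :=
  fun i j => Fin.cases (Fin.cases 0 (fun _ => 1) j) (fun a => Fin.cases 1 (fun b => r a b ^ 2) j) i

/-- Planarity as a RANK condition on the torus: all `5 × 5` minors of the bordered Cayley–Menger
matrix and its determinant vanish — verbatim the cell's staging definition.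
[cite: HamptonJensen2011, §2 p. 4] -/
def cmRankLE4 {K : Type*} [Field K] (r : Fin 5 → Fin 5 → K) : Prop :=
  (∀ i j : Fin 6, Matrix.det ((cmBordered5 r).submatrix (Fin.succAbove i) (Fin.succAbove j)) = 0) ∧
    Matrix.det (cmBordered5 r) = 0

/-- Left factor of the bordered Cayley–Menger matrix of planar points. [folklore] -/
def cmLeft {K : Type*} [Field K] (x y : Fin 5 → K) : Matrix (Fin 6) (Fin 4) K :=
  fun i => Fin.cases ![1, 0, 0, 0] (fun a => ![x a ^ 2 + y a ^ 2, 1, x a, y a]) i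

/-- Right factor of the bordered Cayley–Menger matrix of planar points. [folklore] -/
def cmRight {K : Type*} [Field K] (x y : Fin 5 → K) : Matrix (Fin 4) (Fin 6) K :=
  fun k j => Fin.cases (![0, 1, 0, 0] k) (fun b => ![1, x b ^ 2 + y b ^ 2, -2 * x b, -2 * y b] k) j

/-- Rank factorisation of the bordered Cayley–Menger matrix of five planar points through `K⁴`.
[folklore] -/
theorem cmBordered5_eq_mul {K : Type*} [Field K] (r : Fin 5 → Fin 5 → K) (x y : Fin 5 → K)
    (h : ∀ i j, r i j ^ 2 = (x i - x j) ^ 2 + (y i - y j) ^ 2) :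
    cmBordered5 r = cmLeft x y * cmRight x y := by
  ext i j
  refine Fin.cases ?_ (fun a => ?_) i <;> refine Fin.cases ?_ (fun b => ?_) j
  · simp [cmBordered5, cmLeft, cmRight, Matrix.mul_apply, Fin.sum_univ_four]
  · simp [cmBordered5, cmLeft, cmRight, Matrix.mul_apply, Fin.sum_univ_four]
  · simp [cmBordered5, cmLeft, cmRight, Matrix.mul_apply, Fin.sum_univ_four]
  · simp [cmBordered5, cmLeft, cmRight, Matrix.mul_apply, Fin.sum_univ_four, h]
    ring

/-- PLANAR TORUS DATA SATISFY THE RANK CONDITION: if `r_ij² = (x_i − x_j)² + (y_i − y_j)²` for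
points in `K²`, then `cmRankLE4 r`. [cite: HamptonJensen2011, §2 p. 4 — derived
in-tree] -/
theorem cmRankLE4_of_planar {K : Type*} [Field K] (r : Fin 5 → Fin 5 → K) (x y : Fin 5 → K)
    (h : ∀ i j, r i j ^ 2 = (x i - x j) ^ 2 + (y i - y j) ^ 2) :
    cmRankLE4 r := by
  rw [cmRankLE4, cmBordered5_eq_mul r x y h]
  refine ⟨fun i j => ?_, ?_⟩
  · rw [Matrix.submatrix_mul _ _ (Fin.succAbove i) id (Fin.succAbove j) Function.bijective_id]
    exact det_mul_eq_zero_of_card_lt _ _ (by simp)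
  · exact det_mul_eq_zero_of_card_lt _ _ (by simp)


/-- `|p|²`. [folklore] -/
def normSq (p : ℝ × ℝ) : ℝ := p.1 ^ 2 + p.2 ^ 2

/-- Sum over `i < j` of a symmetric function is half the sum over ordered pairs `i ≠ j`. [folklore] -/
theorem sum_lt_eq_half_sum_ne {n : ℕ} (f : Fin n → Fin n → ℝ) (hf : ∀ i j, f i j = f j i) :
    (∑ i, ∑ j, if i < j then f i j else 0) = (1 / 2) * ∑ i, ∑ j, if i ≠ j then f i j else 0 := by
  have h1 : (∑ i, ∑ j, if i ≠ j then f i j else 0)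
      = (∑ i, ∑ j, if i < j then f i j else 0) + (∑ i, ∑ j, if j < i then f i j else 0) := by
    rw [← Finset.sum_add_distrib]
    refine Finset.sum_congr rfl fun i _ => ?_
    rw [← Finset.sum_add_distrib]
    refine Finset.sum_congr rfl fun j _ => ?_
    rcases lt_trichotomy i j with h | h | h
    · simp [h, h.ne, not_lt.mpr h.le]
    · simp [h]
    · simp [h, h.ne', not_lt.mpr h.le]
  have h2 : (∑ i, ∑ j, if j < i then f i j else 0) = ∑ i, ∑ j, if i < j then f i j else 0 := by
    rw [Finset.sum_comm]
    refine Finset.sum_congr rfl fun i _ => Finset.sum_congr rfl fun j _ => ?_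
    split_ifs <;> simp [hf]
  linarith [h1, h2]

/-- THE POTENTIAL IDENTITY for a real normalized central configuration (system (4)):
`Σ_k m_k |q_k|² = ½ Σ_{k ≠ l} m_k m_l δ_kl`.  (For `δ = +1/r` this is `Σ m_k |q_k|² = U`, the
virial relation at multiplier `1`.) [cite: AlbouyKaloshin2012, system (4) p. 540; HamptonJensen2011,
eq. (7) p. 4 — derived in-tree] -/
theorem realCC_potential_identity {n : ℕ} {m : Fin n → ℝ} {q : Fin n → ℝ × ℝ}
    {δ : Fin n → Fin n → ℝ} (h : IsRealNormalizedCC m q δ) :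
    ∑ k, m k * normSq (q k) = (1 / 2) * ∑ k, ∑ l, if k ≠ l then m k * m l * δ k l else 0 := by
  obtain ⟨hsymm, hδ, hforce, -⟩ := h
  set A : Fin n → Fin n → ℝ := fun k l =>
    m k * m l * δ k l ^ 3 * (((q k).1 - (q l).1) * (q k).1 + ((q k).2 - (q l).2) * (q k).2) with hA
  have hS : ∑ k, m k * normSq (q k) = ∑ k, ∑ l, A k l := by
    refine Finset.sum_congr rfl fun k _ => ?_
    have hk := hforce k
    have h1 : (q k).1 = ∑ l, m l * δ k l ^ 3 * ((q k).1 - (q l).1) := by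
      have := congrArg Prod.fst hk
      simpa [Prod.fst_sum, smul_eq_mul] using this
    have h2 : (q k).2 = ∑ l, m l * δ k l ^ 3 * ((q k).2 - (q l).2) := by
      have := congrArg Prod.snd hk
      simpa [Prod.snd_sum, smul_eq_mul] using this
    have e1 : (q k).1 ^ 2 = (q k).1 * ∑ l, m l * δ k l ^ 3 * ((q k).1 - (q l).1) := by
      rw [sq]; exact congrArg ((q k).1 * ·) h1
    have e2 : (q k).2 ^ 2 = (q k).2 * ∑ l, m l * δ k l ^ 3 * ((q k).2 - (q l).2) := by
      rw [sq]; exact congrArg ((q k).2 * ·) h2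
    simp only [normSq]
    rw [e1, e2, Finset.mul_sum, Finset.mul_sum, ← Finset.sum_add_distrib, Finset.mul_sum]
    refine Finset.sum_congr rfl fun l _ => ?_
    simp only [hA]
    ring
  have hc : ∑ k, ∑ l, A k l = ∑ k, ∑ l, A l k := Finset.sum_comm
  have hpair : ∀ k l, A k l + A l k = m k * m l * δ k l ^ 3 * sqDist (q k) (q l) := by
    intro k l
    simp only [hA, sqDist]
    rw [hsymm l k]
    ring
  have hsum : ∑ k, ∑ l, (A k l + A l k) = ∑ k, ∑ l, (if k ≠ l then m k * m l * δ k l else 0) := by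
    refine Finset.sum_congr rfl fun k _ => Finset.sum_congr rfl fun l _ => ?_
    rw [hpair k l]
    by_cases hkl : k = l
    · subst hkl; simp [sqDist]
    · simp only [hkl, ne_eq, not_false_eq_true, if_true]
      have e := hδ k l hkl
      calc m k * m l * δ k l ^ 3 * sqDist (q k) (q l)
          = m k * m l * δ k l * (δ k l ^ 2 * sqDist (q k) (q l)) := by ring
        _ = m k * m l * δ k l := by rw [e, mul_one]
  calc ∑ k, m k * normSq (q k) = ∑ k, ∑ l, A k l := hS
    _ = (1 / 2) * (∑ k, ∑ l, A k l + ∑ k, ∑ l, A l k) := by rw [← hc]; ring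
    _ = (1 / 2) * ∑ k, ∑ l, (A k l + A l k) := by
        congr 1
        rw [← Finset.sum_add_distrib]
        refine Finset.sum_congr rfl fun k _ => ?_
        rw [← Finset.sum_add_distrib]
    _ = (1 / 2) * ∑ k, ∑ l, (if k ≠ l then m k * m l * δ k l else 0) := by rw [hsum]

/-- THE LAGRANGE / MOMENT-OF-INERTIA IDENTITY for a real normalized central configuration
(centre of mass at the origin): `M · Σ_k m_k |q_k|² = ½ Σ_{k,l} m_k m_l r_kl²`. [folklore] -/
theorem realCC_lagrange_identity {n : ℕ} {m : Fin n → ℝ} {q : Fin n → ℝ × ℝ}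
    {δ : Fin n → Fin n → ℝ} (h : IsRealNormalizedCC m q δ) :
    (∑ k, m k) * ∑ k, m k * normSq (q k) = (1 / 2) * ∑ k, ∑ l, m k * m l * sqDist (q k) (q l) := by
  have hx := isRealNormalizedCC_sum_mass_mul_fst h
  have hy := isRealNormalizedCC_sum_mass_mul_snd h
  have key : ∑ k, ∑ l, m k * m l * sqDist (q k) (q l)
      = ∑ k, ∑ l, (m k * (m l * normSq (q l)) + (m k * normSq (q k)) * m l
          - 2 * ((m k * (q k).1) * (m l * (q l).1)) - 2 * ((m k * (q k).2) * (m l * (q l).2))) := by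
    refine Finset.sum_congr rfl fun k _ => Finset.sum_congr rfl fun l _ => ?_
    simp only [sqDist, normSq]; ring
  have key' : ∑ k, ∑ l, (m k * (m l * normSq (q l)) + (m k * normSq (q k)) * m l
          - 2 * ((m k * (q k).1) * (m l * (q l).1)) - 2 * ((m k * (q k).2) * (m l * (q l).2)))
      = (∑ k, ∑ l, m k * (m l * normSq (q l))) + (∑ k, ∑ l, (m k * normSq (q k)) * m l)
          - (∑ k, ∑ l, 2 * ((m k * (q k).1) * (m l * (q l).1)))
          - (∑ k, ∑ l, 2 * ((m k * (q k).2) * (m l * (q l).2))) := by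
    simp only [Finset.sum_add_distrib, Finset.sum_sub_distrib]
  have t1 : ∑ k, ∑ l, m k * (m l * normSq (q l)) = (∑ k, m k) * (∑ l, m l * normSq (q l)) := by
    rw [Finset.sum_mul_sum]
  have t2 : ∑ k, ∑ l, (m k * normSq (q k)) * m l = (∑ k, m k * normSq (q k)) * (∑ l, m l) := by
    rw [Finset.sum_mul_sum]
  have t3 : ∑ k, ∑ l, 2 * ((m k * (q k).1) * (m l * (q l).1))
      = 2 * ((∑ k, m k * (q k).1) * (∑ l, m l * (q l).1)) := by
    rw [Finset.sum_mul_sum]; simp only [Finset.mul_sum]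
  have t4 : ∑ k, ∑ l, 2 * ((m k * (q k).2) * (m l * (q l).2))
      = 2 * ((∑ k, m k * (q k).2) * (∑ l, m l * (q l).2)) := by
    rw [Finset.sum_mul_sum]; simp only [Finset.mul_sum]
  rw [key, key', t1, t2, t3, t4, hx, hy]
  ring


/-- Hampton–Jensen's `e_IU = Σ_{i<j} m_i m_j (r_ij⁻¹ − r_ij²)` (their eq. (7), normalisation
`λ' = −1`), for any number of bodies. [cite: HamptonJensen2011, eq. (7) p. 4] -/
def eIU {K : Type*} [Field K] {n : ℕ} (m : Fin n → K) (r : Fin n → Fin n → K) : K :=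
  ∑ i, ∑ j, if i < j then m i * m j * ((r i j)⁻¹ - r i j ^ 2) else 0

/-- Solution set of the enriched equation set S3 = {g_ij, four-body CM, bordered-CM rank ≤ 4, e_IU}
on the torus (five bodies). [cite: HamptonJensen2011, §2 p. 4; JensenLeykin2025, §2.3 p. 2] -/
def s3NormalizedCCs (K : Type*) [Field K] (m : Fin 5 → K) : Set (Fin 5 → Fin 5 → K) :=
  {r | r ∈ jlNormalizedCCs K m ∧ cmRankLE4 r ∧ eIU m r = 0}

/-- `S3 ⊆ S1`. [folklore] -/
theorem s3NormalizedCCs_subset (K : Type*) [Field K] (m : Fin 5 → K) :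
    s3NormalizedCCs K m ⊆ jlNormalizedCCs K m := fun _ h => h.1

/-- THE ENERGY RELATION ON THE DICTIONARY IMAGE: for every real normalized central configuration
`(q, δ)` of system (4) and `κ³ Σ m = 1`, `e_IU(m, κ/δ) = 0`.
[cite: HamptonJensen2011, eq. (7) p. 4; AlbouyKaloshin2012, system (4) p. 540 — derived in-tree] -/
theorem eIU_jlOfDelta_eq_zero {n : ℕ} {m : Fin n → ℝ} {q : Fin n → ℝ × ℝ} {δ : Fin n → Fin n → ℝ}
    (h : IsRealNormalizedCC m q δ) (κ : ℝ) (hκ0 : κ ≠ 0) (hκ : κ ^ 3 * ∑ k, m k = 1) :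
    eIU m (jlOfDelta κ δ) = 0 := by
  have hpot := realCC_potential_identity h
  have hlag := realCC_lagrange_identity h
  obtain ⟨hsymm, hδ, -, -⟩ := h
  have hδ0 : ∀ k l, k ≠ l → δ k l ≠ 0 := by
    intro k l hkl h0
    have := hδ k l hkl
    rw [h0] at this
    norm_num at this
  set S := ∑ k, m k * normSq (q k) with hS
  set M := ∑ k, m k with hM
  set F : Fin n → Fin n → ℝ := fun i j => m i * m j * (δ i j / κ - κ ^ 2 / δ i j ^ 2) with hF
  -- step 1: rewrite e_IU on the dictionary image
  have h1 : eIU m (jlOfDelta κ δ) = ∑ i, ∑ j, if i < j then F i j else 0 := by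
    unfold eIU
    refine Finset.sum_congr rfl fun i _ => Finset.sum_congr rfl fun j _ => ?_
    split_ifs with hij
    · have hne : i ≠ j := hij.ne
      simp only [jlOfDelta, hne, if_false, inv_div, div_pow, hF]
    · rfl
  -- step 2: symmetric ⇒ half the sum over ordered pairs
  have hFsymm : ∀ i j, F i j = F j i := by
    intro i j; simp only [hF]; rw [hsymm i j]; ring
  have h2 := sum_lt_eq_half_sum_ne F hFsymm
  -- step 3: split the ordered-pair sum
  have h3 : ∑ i, ∑ j, (if i ≠ j then F i j else 0)
      = (1 / κ) * (∑ i, ∑ j, if i ≠ j then m i * m j * δ i j else 0)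
        - κ ^ 2 * (∑ i, ∑ j, m i * m j * sqDist (q i) (q j)) := by
    rw [Finset.mul_sum, Finset.mul_sum, ← Finset.sum_sub_distrib]
    refine Finset.sum_congr rfl fun i _ => ?_
    rw [Finset.mul_sum, Finset.mul_sum, ← Finset.sum_sub_distrib]
    refine Finset.sum_congr rfl fun j _ => ?_
    by_cases hij : i = j
    · subst hij; simp [sqDist]
    · simp only [hij, ne_eq, not_false_eq_true, if_true, hF]
      have e := hδ i j hij
      have hd0 := hδ0 i j hij
      have hsq : sqDist (q i) (q j) = 1 / δ i j ^ 2 := by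
        field_simp
        linear_combination e
      rw [hsq]
      field_simp
      try ring1
  -- step 4/5: the two identities
  have h4 : ∑ i, ∑ j, (if i ≠ j then m i * m j * δ i j else 0) = 2 * S := by
    rw [hpot]; ring
  have h5 : ∑ i, ∑ j, m i * m j * sqDist (q i) (q j) = 2 * (M * S) := by
    rw [hlag]; ring
  rw [h1, h2, h3, h4, h5]
  have hk : κ ^ 2 * M = 1 / κ := by
    field_simp
    linear_combination hκ
  calc (1 / 2 : ℝ) * (1 / κ * (2 * S) - κ ^ 2 * (2 * (M * S)))
      = S * (1 / κ) - S * (κ ^ 2 * M) := by ring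
    _ = 0 := by rw [hk]; ring

/-- Squared dictionary distances of a configuration are planar data (points `κ q_i`). [folklore] -/
theorem jlOfDelta_deltaOfPos_sq {n : ℕ} (κ : ℝ) (q : Fin n → ℝ × ℝ) (i j : Fin n) :
    jlOfDelta κ (deltaOfPos q) i j ^ 2
      = (κ * (q i).1 - κ * (q j).1) ^ 2 + (κ * (q i).2 - κ * (q j).2) ^ 2 := by
  by_cases hij : i = j
  · subst hij; simp [jlOfDelta]
  · rw [jlOfDelta_deltaOfPos_apply κ q i j hij, mul_pow,
      Real.sq_sqrt (by unfold sqDist; positivity)]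
    unfold sqDist; ring

/-- THE S3 DICTIONARY: a positive normalized central configuration of five bodies, rescaled by
`κ` with `κ³ Σ m = 1`, solves the enriched system S3. [cite: HamptonJensen2011, §2 p. 4;
JensenLeykin2025, §2.4 p. 3; AlbouyKaloshin2012, Definition 1 p. 536 — derived in-tree] -/
theorem jlOfDelta_deltaOfPos_mem_s3 (m : Fin 5 → ℝ) {q : Fin 5 → ℝ × ℝ}
    (hq : IsPositiveNormalizedCC m q) (κ : ℝ) (hκ0 : κ ≠ 0) (hκ : κ ^ 3 * ∑ k, m k = 1) :
    jlOfDelta κ (deltaOfPos q) ∈ s3NormalizedCCs ℝ m := by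
  have hreal := isRealNormalizedCC_of_isPositiveNormalizedCC hq
  refine ⟨jlOfDelta_mem_of_isRealNormalizedCC m q _ hreal κ hκ0 hκ, ?_, ?_⟩
  · exact cmRankLE4_of_planar _ (fun i => κ * (q i).1) (fun i => κ * (q i).2)
      (fun i j => jlOfDelta_deltaOfPos_sq κ q i j)
  · exact eIU_jlOfDelta_eq_zero hreal κ hκ0 hκ

/-- FINITENESS TRANSFER FOR S3: if the enriched torus system S3 is finite at masses `m` with
positive total mass, there are only finitely many positive normalized central configurations of
the five bodies. [cite: AlbouyKaloshin2012, Definition 1 p. 536 — derived in-tree] -/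
theorem positiveNormalizedCCs_finite_of_s3Finite (m : Fin 5 → ℝ) (hM : 0 < ∑ k, m k)
    (hfin : (s3NormalizedCCs ℝ m).Finite) : (positiveNormalizedCCs m).Finite := by
  obtain ⟨κ, hκ0, hκ⟩ := exists_kappa_of_sum_pos m hM
  have hf : ((fun q : Fin 5 → ℝ × ℝ => jlOfDelta κ (deltaOfPos q)) '' positiveNormalizedCCs m).Finite := by
    refine hfin.subset ?_
    rintro _ ⟨q, hq, rfl⟩
    exact jlOfDelta_deltaOfPos_mem_s3 m hq κ hκ0 hκ
  have heq : distanceMatrix '' positiveNormalizedCCs m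
      = (fun r : Fin 5 → Fin 5 → ℝ => fun k l => κ⁻¹ * r k l) ''
          ((fun q : Fin 5 → ℝ × ℝ => jlOfDelta κ (deltaOfPos q)) '' positiveNormalizedCCs m) := by
    rw [Set.image_image]
    refine Set.image_congr fun q _ => ?_
    rw [jlOfDelta_deltaOfPos_eq]
    funext k l
    field_simp
  have hD : (distanceMatrix '' positiveNormalizedCCs m).Finite := by rw [heq]; exact hf.image _
  exact positiveNormalizedCCs_finite_of_distanceMatrix_finite m hM.ne' (by norm_num) hD

/-- The S3 target on `E32`: generic finiteness of the enriched torus system inside the family,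
genericity measured by a nonzero `P ∈ ℚ[a,b,c]` — a TARGET of the cell's S2/S3 certificates.
[cite: JensenLeykin2025, §4.2 p. 6; HamptonJensen2011, §2 p. 4] -/
def E32S3Target : Prop :=
  ∃ P : MvPolynomial (Fin 3) ℚ, P ≠ 0 ∧
    ∀ (K : Type) [Field K] [CharZero K] (a b c : K),
      MvPolynomial.aeval ![a, b, c] P ≠ 0 → (s3NormalizedCCs K ![a, a, b, b, c]).Finite

/-- AN S3 CERTIFICATE GENERIC ON `E32` DECIDES AK-FINITENESS GENERICALLY ON `E32`: with the same
exceptional polynomial, every real `(a,b,c)` with `2a + 2b + c > 0` and `P(a,b,c) ≠ 0` has finitely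
many positive normalized central configurations with masses `(a,a,b,b,c)`.
[cite: AlbouyKaloshin2012, Theorem 2 p. 537, Definition 1 p. 536 — derived in-tree] -/
theorem e32_generic_positiveCC_finite_of_s3Target (h : E32S3Target) :
    ∃ P : MvPolynomial (Fin 3) ℚ, P ≠ 0 ∧ ∀ a b c : ℝ, 0 < 2 * a + 2 * b + c →
      MvPolynomial.aeval ![a, b, c] P ≠ 0 →
        (positiveNormalizedCCs (![a, a, b, b, c] : Fin 5 → ℝ)).Finite := by
  obtain ⟨P, hP0, hP⟩ := h
  refine ⟨P, hP0, fun a b c hM hPabc => ?_⟩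
  have hM' : 0 < ∑ k, (![a, a, b, b, c] : Fin 5 → ℝ) k := by
    simp [Fin.sum_univ_five]; linarith
  exact positiveNormalizedCCs_finite_of_s3Finite _ hM' (hP ℝ a b c hPabc)

end Literature.Dynamics.NBody
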